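import Summits.CriticalPhenomena.PercolationContinuityZ3.Theorems.PercNearOneGluingNoHeavyLowerTailWheelCertificate
import HarnessLib

/-!
# R1 for the random-cluster measure on hub-apex wheels: remaining corners and the assembled
      certificate

Second half of `…LowerTailWheelCertificate.lean` (same memo, `prim-gen-kcluster/KCLUSTER-gen69.md`;
support file for `stmt-CriticalPhenomena-4575`): the corner certificates `(x,y) = (0,1)` and
      `(0,0)` of
the terminal-spoke square and the multi-affine interpolation `wheel_certificate`
(`s_A s_B (T_SP + T_TH) ≤ P·Q` for all `x, y ∈ [0,1]`, given the single-side facts (M2), (LB), (LG)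
      for
both rim sides) — the algebraic core of: R1 `t·s_a ≤ u_b·u_c` holds for every random-cluster measure
`φ_{p,q}`, `q ≥ 1`, on every hub-apex wheel and, more generally, whenever every component of `G −
      a` is
a path or a cycle.  Notation as in the first file.

**General reading (memo §5): 3-sums at the terminal triple.**  Nothing in the algebra is specific to
fans: for ANY two edge-disjoint pieces `G_A, G_B` with `V(G_A) ∩ V(G_B) = {a,b,c}` (edges `ab`, `ac`
kept aside with parameters `x, y`), the R1 quantities of `G = G_A ∪ G_B` are the same polynomials in
the pieces' six cells `T = d+t` (`{abc}`), `b` (`{ab|c}`), `g` (`{ac|b}`), `n` (`{a|bc}`), `s`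
(`{a|b|c}`, `C_a` separates `b|c` inside the piece), `e` (`{a|b|c}`, not separated), each weighted
      by
`q^{#clusters of the piece avoiding a,b,c}` (validated against brute force, memo §5).  In that
language (M2) is R1 for the piece, and (LB)/(LG) are the rows `s_a·u_a ≤ n_a·u_b`, `s_a·u_a ≤
      n_a·u_c`
(consequences of the refined row R4⁺, tree `RefinedRowR4.r4plus_PrW` at `q = 1` and
`SepDual.r4plus_of_r1_rcMeasureW` for `q ≥ 1` given R1).  So `wheel_certificate` says: R1 ∧ LB ∧ LG
      on
both pieces ⟹ R1 on the 3-sum (every `q > 0`), and `lb_glue` / `lg_glue` say LB, LG are preserved,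
so the implication iterates over any number of `{a,b,c}`-bridges; in particular a minimal
counterexample to R1 for `φ_{p,q}`, `q ≥ 1`, has a connected `G − {a,b,c}`.  `ab_cut_certificate`
      and
`bv_cut_certificate` are the (termwise) algebraic cores of the 2-cut lemmas of memo §5.2: a 2-cut
`{a,b}`, `{a,c}`, `{b,v}` or `{c,v}` reduces R1 to R1 + LG (resp. LB) of the far piece. [this work]
-/

namespace Summit.CriticalPhenomena.PercolationContinuityZ3.Theorems

namespace WheelR1
/-- Wheel certificate at the corner `(x,y) = (0,1)` of the terminal-spoke square: the slack is
an explicit non-negative combination of products of single-side slacks (LP certificate, kit j210488;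
exact). [this work] -/
theorem wheel_corner01 (eA sA bA gA dA nA tA eB sB bB gB dB nB tB : ℝ)
    (heA : 0 ≤ eA) (hsA : 0 ≤ sA) (hbA : 0 ≤ bA) (hgA : 0 ≤ gA) (hdA : 0 ≤ dA) (hnA : 0 ≤ nA) (htA
          : 0 ≤ tA)
    (heB : 0 ≤ eB) (hsB : 0 ≤ sB) (hbB : 0 ≤ bB) (hgB : 0 ≤ gB) (hdB : 0 ≤ dB) (hnB : 0 ≤ nB) (htB
          : 0 ≤ tB)
    (hMA : sA * (tA + dA) ≤ bA * gA) (hBA : sA * nA ≤ eA * bA)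
    (hMB : sB * (tB + dB) ≤ bB * gB) (hBB : sB * nB ≤ eB * bB) :
    sA * sB * (((eA + sA) * ((eB + sB) * 0 * 1 + bB * 1 + gB * 0 + dB) + bA * ((eB + sB) * 1 + bB *
          1 + gB + dB) + gA * ((eB + sB) * 0 + bB + gB * 0 + dB) + dA * (eB + sB + bB + gB + dB)) +
          (tA * (eB + sB + bB + gB + dB + nB + tB) + nA * ((eB + sB + bB + gB + dB + nB + tB) - (1
          - 0) * (1 - 1) * ((eB + sB) + nB)) + tB * (eA + sA + bA + gA + dA) + nB * ((eA + sA + bA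
          + gA + dA) - (1 - 0) * (1 - 1) * (eA + sA))))
      ≤ (0 * (eA + sA) * (eB + sB) + (eA + sA) * bB + bA * (eB + sB) + bA * bB) * (1 * (eA + sA) *
            (eB + sB) + (eA + sA) * gB + gA * (eB + sB) + gA * gB) := by
  have t1 : 0 ≤ ((eA + sA + bA) * (eA + sA + gA)) * (bB * gB - sB * (tB + dB)) :=
    mul_nonneg (mul_nonneg (by linarith : (0:ℝ) ≤ (eA + sA + bA)) (by linarith : (0:ℝ) ≤ (eA + sA +
          gA))) (sub_nonneg.mpr hMB)
  have t2 : 0 ≤ (bA * gA - sA * (tA + dA)) * ((eB + sB + bB) * (eB + sB + gB)) :=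
    mul_nonneg (sub_nonneg.mpr hMA) (mul_nonneg (by linarith : (0:ℝ) ≤ (eB + sB + bB)) (by linarith
          : (0:ℝ) ≤ (eB + sB + gB)))
  have t3 : 0 ≤ ((eA + sA + bA) * (eA + sA + gA)) * (eB * bB - sB * nB) :=
    mul_nonneg (mul_nonneg (by linarith : (0:ℝ) ≤ (eA + sA + bA)) (by linarith : (0:ℝ) ≤ (eA + sA +
          gA))) (sub_nonneg.mpr hBB)
  have t4 : 0 ≤ (eA * bA - sA * nA) * ((eB + sB + bB) * (eB + sB + gB)) :=
    mul_nonneg (sub_nonneg.mpr hBA) (mul_nonneg (by linarith : (0:ℝ) ≤ (eB + sB + bB)) (by linarith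
          : (0:ℝ) ≤ (eB + sB + gB)))
  have t5 : 0 ≤ (sA * (eA + sA + bA + gA + dA + nA + tA)) * (bB * gB - sB * (tB + dB)) :=
    mul_nonneg (mul_nonneg (by linarith : (0:ℝ) ≤ sA) (by linarith : (0:ℝ) ≤ (eA + sA + bA + gA +
          dA + nA + tA))) (sub_nonneg.mpr hMB)
  have t6 : 0 ≤ (bA * gA - sA * (tA + dA)) * (sB * (eB + sB + bB + gB + dB + nB + tB)) :=
    mul_nonneg (sub_nonneg.mpr hMA) (mul_nonneg (by linarith : (0:ℝ) ≤ sB) (by linarith : (0:ℝ) ≤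
          (eB + sB + bB + gB + dB + nB + tB)))
  have t7 : 0 ≤ (sA * (eA + sA + bA + gA + dA + nA + tA)) * (eB * bB - sB * nB) :=
    mul_nonneg (mul_nonneg (by linarith : (0:ℝ) ≤ sA) (by linarith : (0:ℝ) ≤ (eA + sA + bA + gA +
          dA + nA + tA))) (sub_nonneg.mpr hBB)
  have t8 : 0 ≤ (eA * bA - sA * nA) * (sB * (eB + sB + bB + gB + dB + nB + tB)) :=
    mul_nonneg (sub_nonneg.mpr hBA) (mul_nonneg (by linarith : (0:ℝ) ≤ sB) (by linarith : (0:ℝ) ≤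
          (eB + sB + bB + gB + dB + nB + tB)))
  have t9 : 0 ≤ (eA * (eA + sA + gA)) * (bB * (eB + sB + gB)) :=
    mul_nonneg (mul_nonneg (by linarith : (0:ℝ) ≤ eA) (by linarith : (0:ℝ) ≤ (eA + sA + gA)))
          (mul_nonneg (by linarith : (0:ℝ) ≤ bB) (by linarith : (0:ℝ) ≤ (eB + sB + gB)))
  have t10 : 0 ≤ (bA * (eA + sA + gA)) * (eB * (eB + sB + gB)) :=
    mul_nonneg (mul_nonneg (by linarith : (0:ℝ) ≤ bA) (by linarith : (0:ℝ) ≤ (eA + sA + gA)))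
          (mul_nonneg (by linarith : (0:ℝ) ≤ eB) (by linarith : (0:ℝ) ≤ (eB + sB + gB)))
  have t11 : 0 ≤ (eA * (eA + sA + gA)) * (sB * (bB + dB)) :=
    mul_nonneg (mul_nonneg (by linarith : (0:ℝ) ≤ eA) (by linarith : (0:ℝ) ≤ (eA + sA + gA)))
          (mul_nonneg (by linarith : (0:ℝ) ≤ sB) (by linarith : (0:ℝ) ≤ (bB + dB)))
  have t12 : 0 ≤ (sA * (bA + dA)) * (eB * (eB + sB + gB)) :=
    mul_nonneg (mul_nonneg (by linarith : (0:ℝ) ≤ sA) (by linarith : (0:ℝ) ≤ (bA + dA)))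
          (mul_nonneg (by linarith : (0:ℝ) ≤ eB) (by linarith : (0:ℝ) ≤ (eB + sB + gB)))
  have t13 : 0 ≤ (eA * (eA + sA + gA)) * (sB * (nB + tB)) :=
    mul_nonneg (mul_nonneg (by linarith : (0:ℝ) ≤ eA) (by linarith : (0:ℝ) ≤ (eA + sA + gA)))
          (mul_nonneg (by linarith : (0:ℝ) ≤ sB) (by linarith : (0:ℝ) ≤ (nB + tB)))
  have t14 : 0 ≤ (sA * (nA + tA)) * (eB * (eB + sB + gB)) :=
    mul_nonneg (mul_nonneg (by linarith : (0:ℝ) ≤ sA) (by linarith : (0:ℝ) ≤ (nA + tA)))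
          (mul_nonneg (by linarith : (0:ℝ) ≤ eB) (by linarith : (0:ℝ) ≤ (eB + sB + gB)))
  have key : (0 * (eA + sA) * (eB + sB) + (eA + sA) * bB + bA * (eB + sB) + bA * bB) * (1 * (eA +
        sA) * (eB + sB) + (eA + sA) * gB + gA * (eB + sB) + gA * gB) - sA * sB * (((eA + sA) * ((eB
        + sB) * 0 * 1 + bB * 1 + gB * 0 + dB) + bA * ((eB + sB) * 1 + bB * 1 + gB + dB) + gA * ((eB
        + sB) * 0 + bB + gB * 0 + dB) + dA * (eB + sB + bB + gB + dB)) + (tA * (eB + sB + bB + gB +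
        dB + nB + tB) + nA * ((eB + sB + bB + gB + dB + nB + tB) - (1 - 0) * (1 - 1) * ((eB + sB) +
        nB)) + tB * (eA + sA + bA + gA + dA) + nB * ((eA + sA + bA + gA + dA) - (1 - 0) * (1 - 1) *
        (eA + sA))))
      = (1/2:ℝ) * (((eA + sA + bA) * (eA + sA + gA)) * (bB * gB - sB * (tB + dB))) + (1/2:ℝ) * ((bA
            * gA - sA * (tA + dA)) * ((eB + sB + bB) * (eB + sB + gB))) + (1/2:ℝ) * (((eA + sA +
            bA) * (eA + sA + gA)) * (eB * bB - sB * nB)) + (1/2:ℝ) * ((eA * bA - sA * nA) * ((eB +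
            sB + bB) * (eB + sB + gB))) + (1/2:ℝ) * ((sA * (eA + sA + bA + gA + dA + nA + tA)) *
            (bB * gB - sB * (tB + dB))) + (1/2:ℝ) * ((bA * gA - sA * (tA + dA)) * (sB * (eB + sB +
            bB + gB + dB + nB + tB))) + (1/2:ℝ) * ((sA * (eA + sA + bA + gA + dA + nA + tA)) * (eB
            * bB - sB * nB)) + (1/2:ℝ) * ((eA * bA - sA * nA) * (sB * (eB + sB + bB + gB + dB + nB
            + tB))) + (1/2:ℝ) * ((eA * (eA + sA + gA)) * (bB * (eB + sB + gB))) + (1/2:ℝ) * ((bA *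
            (eA + sA + gA)) * (eB * (eB + sB + gB))) + (1/2:ℝ) * ((eA * (eA + sA + gA)) * (sB * (bB
            + dB))) + (1/2:ℝ) * ((sA * (bA + dA)) * (eB * (eB + sB + gB))) + (1/2:ℝ) * ((eA * (eA +
            sA + gA)) * (sB * (nB + tB))) + (1/2:ℝ) * ((sA * (nA + tA)) * (eB * (eB + sB + gB))) :=
            by ring
  linarith [t1, t2, t3, t4, t5, t6, t7, t8, t9, t10, t11, t12, t13, t14, key]

/-- Wheel certificate at the corner `(x,y) = (0,0)` of the terminal-spoke square: the slack is
an explicit non-negative combination of products of single-side slacks (LP certificate, kit j210488;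
exact). [this work] -/
theorem wheel_corner00 (eA sA bA gA dA nA tA eB sB bB gB dB nB tB : ℝ)
    (heA : 0 ≤ eA) (hsA : 0 ≤ sA) (hbA : 0 ≤ bA) (hgA : 0 ≤ gA) (hdA : 0 ≤ dA) (hnA : 0 ≤ nA) (htA
          : 0 ≤ tA)
    (heB : 0 ≤ eB) (hsB : 0 ≤ sB) (hbB : 0 ≤ bB) (hgB : 0 ≤ gB) (hdB : 0 ≤ dB) (hnB : 0 ≤ nB) (htB
          : 0 ≤ tB)
    (hMA : sA * (tA + dA) ≤ bA * gA) (hBA : sA * nA ≤ eA * bA) (hGA : sA * nA ≤ eA * gA)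
    (hMB : sB * (tB + dB) ≤ bB * gB) (hBB : sB * nB ≤ eB * bB) (hGB : sB * nB ≤ eB * gB) :
    sA * sB * (((eA + sA) * ((eB + sB) * 0 * 0 + bB * 0 + gB * 0 + dB) + bA * ((eB + sB) * 0 + bB *
          0 + gB + dB) + gA * ((eB + sB) * 0 + bB + gB * 0 + dB) + dA * (eB + sB + bB + gB + dB)) +
          (tA * (eB + sB + bB + gB + dB + nB + tB) + nA * ((eB + sB + bB + gB + dB + nB + tB) - (1
          - 0) * (1 - 0) * ((eB + sB) + nB)) + tB * (eA + sA + bA + gA + dA) + nB * ((eA + sA + bA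
          + gA + dA) - (1 - 0) * (1 - 0) * (eA + sA))))
      ≤ (0 * (eA + sA) * (eB + sB) + (eA + sA) * bB + bA * (eB + sB) + bA * bB) * (0 * (eA + sA) *
            (eB + sB) + (eA + sA) * gB + gA * (eB + sB) + gA * gB) := by
  have t1 : 0 ≤ (sA * gA) * (eB * bB - sB * nB) :=
    mul_nonneg (mul_nonneg (by linarith : (0:ℝ) ≤ sA) (by linarith : (0:ℝ) ≤ gA)) (sub_nonneg.mpr
          hBB)
  have t2 : 0 ≤ (eA * bA - sA * nA) * (sB * gB) :=
    mul_nonneg (sub_nonneg.mpr hBA) (mul_nonneg (by linarith : (0:ℝ) ≤ sB) (by linarith : (0:ℝ) ≤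
          gB))
  have t3 : 0 ≤ (eA * bA) * (sB * nB) :=
    mul_nonneg (mul_nonneg (by linarith : (0:ℝ) ≤ eA) (by linarith : (0:ℝ) ≤ bA)) (mul_nonneg (by
          linarith : (0:ℝ) ≤ sB) (by linarith : (0:ℝ) ≤ nB))
  have t4 : 0 ≤ (sA * nA) * (eB * bB) :=
    mul_nonneg (mul_nonneg (by linarith : (0:ℝ) ≤ sA) (by linarith : (0:ℝ) ≤ nA)) (mul_nonneg (by
          linarith : (0:ℝ) ≤ eB) (by linarith : (0:ℝ) ≤ bB))
  have t5 : 0 ≤ (bA * (eA + sA)) * (eB * gB - sB * nB) :=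
    mul_nonneg (mul_nonneg (by linarith : (0:ℝ) ≤ bA) (by linarith : (0:ℝ) ≤ (eA + sA)))
          (sub_nonneg.mpr hGB)
  have t6 : 0 ≤ (eA * gA - sA * nA) * (bB * (eB + sB)) :=
    mul_nonneg (sub_nonneg.mpr hGA) (mul_nonneg (by linarith : (0:ℝ) ≤ bB) (by linarith : (0:ℝ) ≤
          (eB + sB)))
  have t7 : 0 ≤ ((eA + sA + bA) * (eA + sA + gA)) * (bB * gB - sB * (tB + dB)) :=
    mul_nonneg (mul_nonneg (by linarith : (0:ℝ) ≤ (eA + sA + bA)) (by linarith : (0:ℝ) ≤ (eA + sA +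
          gA))) (sub_nonneg.mpr hMB)
  have t8 : 0 ≤ (bA * gA - sA * (tA + dA)) * ((eB + sB + bB) * (eB + sB + gB)) :=
    mul_nonneg (sub_nonneg.mpr hMA) (mul_nonneg (by linarith : (0:ℝ) ≤ (eB + sB + bB)) (by linarith
          : (0:ℝ) ≤ (eB + sB + gB)))
  have t9 : 0 ≤ (sA * (eA + sA + bA + gA + dA + nA + tA)) * (bB * gB - sB * (tB + dB)) :=
    mul_nonneg (mul_nonneg (by linarith : (0:ℝ) ≤ sA) (by linarith : (0:ℝ) ≤ (eA + sA + bA + gA +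
          dA + nA + tA))) (sub_nonneg.mpr hMB)
  have t10 : 0 ≤ (bA * gA - sA * (tA + dA)) * (sB * (eB + sB + bB + gB + dB + nB + tB)) :=
    mul_nonneg (sub_nonneg.mpr hMA) (mul_nonneg (by linarith : (0:ℝ) ≤ sB) (by linarith : (0:ℝ) ≤
          (eB + sB + bB + gB + dB + nB + tB)))
  have t11 : 0 ≤ (sA * (tA + dA)) * (eB * gB - sB * nB) :=
    mul_nonneg (mul_nonneg (by linarith : (0:ℝ) ≤ sA) (by linarith : (0:ℝ) ≤ (tA + dA)))
          (sub_nonneg.mpr hGB)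
  have t12 : 0 ≤ (eA * gA - sA * nA) * (sB * (tB + dB)) :=
    mul_nonneg (sub_nonneg.mpr hGA) (mul_nonneg (by linarith : (0:ℝ) ≤ sB) (by linarith : (0:ℝ) ≤
          (tB + dB)))
  have t13 : 0 ≤ (eA * (eA + sA + bA)) * (bB * gB) :=
    mul_nonneg (mul_nonneg (by linarith : (0:ℝ) ≤ eA) (by linarith : (0:ℝ) ≤ (eA + sA + bA)))
          (mul_nonneg (by linarith : (0:ℝ) ≤ bB) (by linarith : (0:ℝ) ≤ gB))
  have t14 : 0 ≤ (bA * gA) * (eB * (eB + sB + bB)) :=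
    mul_nonneg (mul_nonneg (by linarith : (0:ℝ) ≤ bA) (by linarith : (0:ℝ) ≤ gA)) (mul_nonneg (by
          linarith : (0:ℝ) ≤ eB) (by linarith : (0:ℝ) ≤ (eB + sB + bB)))
  have t15 : 0 ≤ (bA * (eA + sA + gA)) * (eB * gB - sB * nB) :=
    mul_nonneg (mul_nonneg (by linarith : (0:ℝ) ≤ bA) (by linarith : (0:ℝ) ≤ (eA + sA + gA)))
          (sub_nonneg.mpr hGB)
  have t16 : 0 ≤ (eA * gA - sA * nA) * (bB * (eB + sB + gB)) :=
    mul_nonneg (sub_nonneg.mpr hGA) (mul_nonneg (by linarith : (0:ℝ) ≤ bB) (by linarith : (0:ℝ) ≤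
          (eB + sB + gB)))
  have t17 : 0 ≤ (eA * (eA + sA + bA)) * (sB * (tB + dB)) :=
    mul_nonneg (mul_nonneg (by linarith : (0:ℝ) ≤ eA) (by linarith : (0:ℝ) ≤ (eA + sA + bA)))
          (mul_nonneg (by linarith : (0:ℝ) ≤ sB) (by linarith : (0:ℝ) ≤ (tB + dB)))
  have t18 : 0 ≤ (sA * (tA + dA)) * (eB * (eB + sB + bB)) :=
    mul_nonneg (mul_nonneg (by linarith : (0:ℝ) ≤ sA) (by linarith : (0:ℝ) ≤ (tA + dA)))
          (mul_nonneg (by linarith : (0:ℝ) ≤ eB) (by linarith : (0:ℝ) ≤ (eB + sB + bB)))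
  have key : (0 * (eA + sA) * (eB + sB) + (eA + sA) * bB + bA * (eB + sB) + bA * bB) * (0 * (eA +
        sA) * (eB + sB) + (eA + sA) * gB + gA * (eB + sB) + gA * gB) - sA * sB * (((eA + sA) * ((eB
        + sB) * 0 * 0 + bB * 0 + gB * 0 + dB) + bA * ((eB + sB) * 0 + bB * 0 + gB + dB) + gA * ((eB
        + sB) * 0 + bB + gB * 0 + dB) + dA * (eB + sB + bB + gB + dB)) + (tA * (eB + sB + bB + gB +
        dB + nB + tB) + nA * ((eB + sB + bB + gB + dB + nB + tB) - (1 - 0) * (1 - 0) * ((eB + sB) +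
        nB)) + tB * (eA + sA + bA + gA + dA) + nB * ((eA + sA + bA + gA + dA) - (1 - 0) * (1 - 0) *
        (eA + sA))))
      = (sA * gA) * (eB * bB - sB * nB) + (eA * bA - sA * nA) * (sB * gB) + (eA * bA) * (sB * nB) +
            (sA * nA) * (eB * bB) + (1/2:ℝ) * ((bA * (eA + sA)) * (eB * gB - sB * nB)) + (1/2:ℝ) *
            ((eA * gA - sA * nA) * (bB * (eB + sB))) + (1/2:ℝ) * (((eA + sA + bA) * (eA + sA + gA))
            * (bB * gB - sB * (tB + dB))) + (1/2:ℝ) * ((bA * gA - sA * (tA + dA)) * ((eB + sB + bB)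
            * (eB + sB + gB))) + (1/2:ℝ) * ((sA * (eA + sA + bA + gA + dA + nA + tA)) * (bB * gB -
            sB * (tB + dB))) + (1/2:ℝ) * ((bA * gA - sA * (tA + dA)) * (sB * (eB + sB + bB + gB +
            dB + nB + tB))) + (1/2:ℝ) * ((sA * (tA + dA)) * (eB * gB - sB * nB)) + (1/2:ℝ) * ((eA *
            gA - sA * nA) * (sB * (tB + dB))) + (1/2:ℝ) * ((eA * (eA + sA + bA)) * (bB * gB)) +
            (1/2:ℝ) * ((bA * gA) * (eB * (eB + sB + bB))) + (1/2:ℝ) * ((bA * (eA + sA + gA)) * (eB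
            * gB - sB * nB)) + (1/2:ℝ) * ((eA * gA - sA * nA) * (bB * (eB + sB + gB))) + (1/2:ℝ) *
            ((eA * (eA + sA + bA)) * (sB * (tB + dB))) + (1/2:ℝ) * ((sA * (tA + dA)) * (eB * (eB +
            sB + bB))) := by ring
  linarith [t1, t2, t3, t4, t5, t6, t7, t8, t9, t10, t11, t12, t13, t14, t15, t16, t17, t18, key]

/-- **Wheel certificate (R1 on hub-apex wheels, algebraic core).**  For every pair of sides
satisfying (M2), (LB), (LG) and all terminal spoke parameters `x, y ∈ [0,1]`:
`s_A s_B (T_SP + T_TH) ≤ P·Q`, i.e. `t·s_a ≤ u_b·u_c` on the wheel (memo §2: the two members are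
      `T·S`
and `U_b·U_c` up to the common factor `(1-x)(1-y)q²/Z²`).  Multi-affine interpolation of the four
corners. [this work] -/
theorem wheel_certificate (eA sA bA gA dA nA tA eB sB bB gB dB nB tB : ℝ) (x y : ℝ)
    (heA : 0 ≤ eA) (hsA : 0 ≤ sA) (hbA : 0 ≤ bA) (hgA : 0 ≤ gA) (hdA : 0 ≤ dA) (hnA : 0 ≤ nA) (htA
          : 0 ≤ tA)
    (heB : 0 ≤ eB) (hsB : 0 ≤ sB) (hbB : 0 ≤ bB) (hgB : 0 ≤ gB) (hdB : 0 ≤ dB) (hnB : 0 ≤ nB) (htB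
          : 0 ≤ tB)
    (hx0 : 0 ≤ x) (hx1 : x ≤ 1) (hy0 : 0 ≤ y) (hy1 : y ≤ 1)
    (hMA : sA * (tA + dA) ≤ bA * gA) (hBA : sA * nA ≤ eA * bA) (hGA : sA * nA ≤ eA * gA)
    (hMB : sB * (tB + dB) ≤ bB * gB) (hBB : sB * nB ≤ eB * bB) (hGB : sB * nB ≤ eB * gB)
    (aA aB NA NB MA MB TSP TTH P Q : ℝ) (eaA : aA = eA + sA) (eaB : aB = eB + sB)
    (eNA : NA = aA + bA + gA + dA) (eNB : NB = aB + bB + gB + dB) (eMA : MA = NA + nA + tA)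
    (eMB : MB = NB + nB + tB)
    (eTSP : TSP = aA * (aB * x * y + bB * y + gB * x + dB) + bA * (aB * y + bB * y + gB + dB)
      + gA * (aB * x + bB + gB * x + dB) + dA * NB)
    (eTTH : TTH = tA * MB + nA * (MB - (1 - x) * (1 - y) * (aB + nB)) + tB * NA
      + nB * (NA - (1 - x) * (1 - y) * aA))
    (eP : P = x * aA * aB + aA * bB + bA * aB + bA * bB)
    (eQ : Q = y * aA * aB + aA * gB + gA * aB + gA * gB) :
    sA * sB * (TSP + TTH) ≤ P * Q := by
  have c00 := wheel_corner00 eA sA bA gA dA nA tA eB sB bB gB dB nB tB heA hsA hbA hgA hdA hnA htA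
        heB hsB hbB
    hgB hdB hnB htB hMA hBA hGA hMB hBB hGB
  have c10 := wheel_corner10 eA sA bA gA dA nA tA eB sB bB gB dB nB tB heA hsA hbA hgA hdA hnA htA
        heB hsB hbB
    hgB hdB hnB htB hMA hGA hMB hGB
  have c01 := wheel_corner01 eA sA bA gA dA nA tA eB sB bB gB dB nB tB heA hsA hbA hgA hdA hnA htA
        heB hsB hbB
    hgB hdB hnB htB hMA hBA hMB hBB
  have c11 := wheel_corner11 eA sA bA gA dA nA tA eB sB bB gB dB nB tB heA hsA hbA hgA hdA hnA htA
        heB hsB hbB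
    hgB hdB hnB htB hMA hBA hMB hBB
  subst eaA eaB
  subst eNA eNB
  subst eMA eMB eTSP eTTH eP eQ
  have key : (x * (eA + sA) * (eB + sB) + (eA + sA) * bB + bA * (eB + sB) + bA * bB) * (y * (eA +
        sA) * (eB + sB) + (eA + sA) * gB + gA * (eB + sB) + gA * gB) - sA * sB * (((eA + sA) * ((eB
        + sB) * x * y + bB * y + gB * x + dB) + bA * ((eB + sB) * y + bB * y + gB + dB) + gA * ((eB
        + sB) * x + bB + gB * x + dB) + dA * (eB + sB + bB + gB + dB)) + (tA * (eB + sB + bB + gB +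
        dB + nB + tB) + nA * ((eB + sB + bB + gB + dB + nB + tB) - (1 - x) * (1 - y) * ((eB + sB) +
        nB)) + tB * (eA + sA + bA + gA + dA) + nB * ((eA + sA + bA + gA + dA) - (1 - x) * (1 - y) *
        (eA + sA))))
      = (1 - x) * (1 - y) * ((0 * (eA + sA) * (eB + sB) + (eA + sA) * bB + bA * (eB + sB) + bA *
            bB) * (0 * (eA + sA) * (eB + sB) + (eA + sA) * gB + gA * (eB + sB) + gA * gB) - sA * sB
            * (((eA + sA) * ((eB + sB) * 0 * 0 + bB * 0 + gB * 0 + dB) + bA * ((eB + sB) * 0 + bB *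
            0 + gB + dB) + gA * ((eB + sB) * 0 + bB + gB * 0 + dB) + dA * (eB + sB + bB + gB + dB))
            + (tA * (eB + sB + bB + gB + dB + nB + tB) + nA * ((eB + sB + bB + gB + dB + nB + tB) -
            (1 - 0) * (1 - 0) * ((eB + sB) + nB)) + tB * (eA + sA + bA + gA + dA) + nB * ((eA + sA
            + bA + gA + dA) - (1 - 0) * (1 - 0) * (eA + sA)))))
        + x * (1 - y) * ((1 * (eA + sA) * (eB + sB) + (eA + sA) * bB + bA * (eB + sB) + bA * bB) *
              (0 * (eA + sA) * (eB + sB) + (eA + sA) * gB + gA * (eB + sB) + gA * gB) - sA * sB *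
              (((eA + sA) * ((eB + sB) * 1 * 0 + bB * 0 + gB * 1 + dB) + bA * ((eB + sB) * 0 + bB *
              0 + gB + dB) + gA * ((eB + sB) * 1 + bB + gB * 1 + dB) + dA * (eB + sB + bB + gB +
              dB)) + (tA * (eB + sB + bB + gB + dB + nB + tB) + nA * ((eB + sB + bB + gB + dB + nB
              + tB) - (1 - 1) * (1 - 0) * ((eB + sB) + nB)) + tB * (eA + sA + bA + gA + dA) + nB *
              ((eA + sA + bA + gA + dA) - (1 - 1) * (1 - 0) * (eA + sA)))))
        + (1 - x) * y * ((0 * (eA + sA) * (eB + sB) + (eA + sA) * bB + bA * (eB + sB) + bA * bB) *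
              (1 * (eA + sA) * (eB + sB) + (eA + sA) * gB + gA * (eB + sB) + gA * gB) - sA * sB *
              (((eA + sA) * ((eB + sB) * 0 * 1 + bB * 1 + gB * 0 + dB) + bA * ((eB + sB) * 1 + bB *
              1 + gB + dB) + gA * ((eB + sB) * 0 + bB + gB * 0 + dB) + dA * (eB + sB + bB + gB +
              dB)) + (tA * (eB + sB + bB + gB + dB + nB + tB) + nA * ((eB + sB + bB + gB + dB + nB
              + tB) - (1 - 0) * (1 - 1) * ((eB + sB) + nB)) + tB * (eA + sA + bA + gA + dA) + nB *
              ((eA + sA + bA + gA + dA) - (1 - 0) * (1 - 1) * (eA + sA)))))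
        + x * y * ((1 * (eA + sA) * (eB + sB) + (eA + sA) * bB + bA * (eB + sB) + bA * bB) * (1 *
              (eA + sA) * (eB + sB) + (eA + sA) * gB + gA * (eB + sB) + gA * gB) - sA * sB * (((eA
              + sA) * ((eB + sB) * 1 * 1 + bB * 1 + gB * 1 + dB) + bA * ((eB + sB) * 1 + bB * 1 +
              gB + dB) + gA * ((eB + sB) * 1 + bB + gB * 1 + dB) + dA * (eB + sB + bB + gB + dB)) +
              (tA * (eB + sB + bB + gB + dB + nB + tB) + nA * ((eB + sB + bB + gB + dB + nB + tB) -
              (1 - 1) * (1 - 1) * ((eB + sB) + nB)) + tB * (eA + sA + bA + gA + dA) + nB * ((eA +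
              sA + bA + gA + dA) - (1 - 1) * (1 - 1) * (eA + sA))))) := by
    ring
  linarith [mul_nonneg (mul_nonneg (sub_nonneg.mpr hx1) (sub_nonneg.mpr hy1)) (sub_nonneg.mpr c00),
    mul_nonneg (mul_nonneg hx0 (sub_nonneg.mpr hy1)) (sub_nonneg.mpr c10),
    mul_nonneg (mul_nonneg (sub_nonneg.mpr hx1) hy0) (sub_nonneg.mpr c01),
    mul_nonneg (mul_nonneg hx0 hy0) (sub_nonneg.mpr c11), key]

/-- **LB is preserved under 3-sums at `{a,b,c}`.**  With piece cells as above, the row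
`s_a·u_a ≤ n_a·u_b` of the glued graph reads (common factor `(1-x)(1-y)² q³` dropped)
`(1-x)·s_A s_B (n_A n_B + n_A a_B + a_A n_B) ≤ (a_A a_B − s_A s_B)(x a_A a_B + a_A b_B + b_A a_B +
      b_A b_B)`,
and it follows from (LB) on the two pieces. [this work] -/
theorem lb_glue (eA sA bA nA eB sB bB nB x : ℝ) (heA : 0 ≤ eA) (hsA : 0 ≤ sA) (hbA : 0 ≤ bA)
    (hnA : 0 ≤ nA) (heB : 0 ≤ eB) (hsB : 0 ≤ sB) (hbB : 0 ≤ bB) (hnB : 0 ≤ nB)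
    (hx0 : 0 ≤ x)
    (hBA : sA * nA ≤ eA * bA) (hBB : sB * nB ≤ eB * bB) :
    (1 - x) * (sA * sB * (nA * nB + nA * (eB + sB) + (eA + sA) * nB))
      ≤ ((eA + sA) * (eB + sB) - sA * sB)
        * (x * (eA + sA) * (eB + sB) + (eA + sA) * bB + bA * (eB + sB) + bA * bB) := by
  have hLA : 0 ≤ eA * bA - sA * nA := sub_nonneg.mpr hBA
  have hLB : 0 ≤ eB * bB - sB * nB := sub_nonneg.mpr hBB
  have haA : 0 ≤ eA + sA := by linarith
  have haB : 0 ≤ eB + sB := by linarith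
  have t1 : 0 ≤ x * (((eA * (eB + sB) + sA * eB) * (eA + sA)) * (eB + sB)
      + sA * sB * (nA * nB + nA * (eB + sB) + (eA + sA) * nB)) :=
    mul_nonneg hx0 (add_nonneg (mul_nonneg (mul_nonneg (add_nonneg (mul_nonneg heA haB)
      (mul_nonneg hsA heB)) haA) haB) (mul_nonneg (mul_nonneg hsA hsB) (add_nonneg (add_nonneg
      (mul_nonneg hnA hnB) (mul_nonneg hnA haB)) (mul_nonneg haA hnB))))
  have t2 : 0 ≤ (eB + sB) * bB * (eA * bA - sA * nA) := mul_nonneg (mul_nonneg haB hbB) hLA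
  have t3 : 0 ≤ sA * nA * (eB * bB - sB * nB) := mul_nonneg (mul_nonneg hsA hnA) hLB
  have t4 : 0 ≤ sA * nA * (sB * bB) := mul_nonneg (mul_nonneg hsA hnA) (mul_nonneg hsB hbB)
  have t5 : 0 ≤ (eB + sB) * (eB + sB) * (eA * bA - sA * nA) := mul_nonneg (mul_nonneg haB haB) hLA
  have t6 : 0 ≤ (eB + sB) * (sA * nA) * eB := mul_nonneg (mul_nonneg haB (mul_nonneg hsA hnA)) heB
  have t7 : 0 ≤ sA * (eA + sA) * (eB * bB - sB * nB) := mul_nonneg (mul_nonneg hsA haA) hLB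
  have t8 : 0 ≤ eA * (eB + sB) * ((eA + sA) * bB) := mul_nonneg (mul_nonneg heA haB) (mul_nonneg
        haA hbB)
  have t9 : 0 ≤ sA * eB * (bA * (eB + sB)) := mul_nonneg (mul_nonneg hsA heB) (mul_nonneg hbA haB)
  have t10 : 0 ≤ sA * eB * (bA * bB) := mul_nonneg (mul_nonneg hsA heB) (mul_nonneg hbA hbB)
  have key : ((eA + sA) * (eB + sB) - sA * sB)
        * (x * (eA + sA) * (eB + sB) + (eA + sA) * bB + bA * (eB + sB) + bA * bB)
      - (1 - x) * (sA * sB * (nA * nB + nA * (eB + sB) + (eA + sA) * nB))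
      = x * (((eA * (eB + sB) + sA * eB) * (eA + sA)) * (eB + sB)
          + sA * sB * (nA * nB + nA * (eB + sB) + (eA + sA) * nB))
        + (eB + sB) * bB * (eA * bA - sA * nA) + sA * nA * (eB * bB - sB * nB) + sA * nA * (sB * bB)
        + (eB + sB) * (eB + sB) * (eA * bA - sA * nA) + (eB + sB) * (sA * nA) * eB
        + sA * (eA + sA) * (eB * bB - sB * nB)
        + eA * (eB + sB) * ((eA + sA) * bB) + sA * eB * (bA * (eB + sB)) + sA * eB * (bA * bB) :=
              by ring
  linarith [t1, t2, t3, t4, t5, t6, t7, t8, t9, t10, key]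

/-- **LG is preserved under 3-sums at `{a,b,c}`** (the `b ↔ c` mirror of `lb_glue`, with `y` in
place of `x`). [this work] -/
theorem lg_glue (eA sA gA nA eB sB gB nB y : ℝ) (heA : 0 ≤ eA) (hsA : 0 ≤ sA) (hgA : 0 ≤ gA)
    (hnA : 0 ≤ nA) (heB : 0 ≤ eB) (hsB : 0 ≤ sB) (hgB : 0 ≤ gB) (hnB : 0 ≤ nB)
    (hy0 : 0 ≤ y)
    (hGA : sA * nA ≤ eA * gA) (hGB : sB * nB ≤ eB * gB) :
    (1 - y) * (sA * sB * (nA * nB + nA * (eB + sB) + (eA + sA) * nB))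
      ≤ ((eA + sA) * (eB + sB) - sA * sB)
        * (y * (eA + sA) * (eB + sB) + (eA + sA) * gB + gA * (eB + sB) + gA * gB) :=
  lb_glue eA sA gA nA eB sB gB nB y heA hsA hgA hnA heB hsB hgB hnB hy0 hGA hGB

/-- **`{a,b}`-cut lemma (algebraic core, memo §5.2(b)).**  `G = G₁ ∪_{a,b} G₂` with `c ∈ G₂`; `α,
      β` = weights
of `a ↔ b` / `a ↮ b` in `G₁`; `t, ub, uc, ua, s, n` = the six cells of `(G₂; a; b, c)`.  Then
      (common powers
of `q` dropped) `T = α(t+uc+ua) + βt`, `U_b = α(ub+s+n) + β·ub`, `U_c = β·uc`, `S = β·s`, and R1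
      together
with LG on the far piece give `T·S ≤ U_b·U_c` termwise. [this work] -/
theorem ab_cut_certificate (α β t ub uc ua s n : ℝ) (hα : 0 ≤ α) (hβ : 0 ≤ β)
    (hR1 : s * t ≤ ub * uc) (hLG : s * ua ≤ n * uc) :
    (α * (t + uc + ua) + β * t) * (β * s) ≤ (α * (ub + s + n) + β * ub) * (β * uc) := by
  have key : (α * (ub + s + n) + β * ub) * (β * uc) - (α * (t + uc + ua) + β * t) * (β * s)
      = β * (α * ((ub * uc - s * t) + (n * uc - s * ua)) + β * (ub * uc - s * t)) := by ring
  have h1 : 0 ≤ α * ((ub * uc - s * t) + (n * uc - s * ua)) :=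
    mul_nonneg hα (by linarith)
  have h2 : 0 ≤ β * (ub * uc - s * t) := mul_nonneg hβ (by linarith)
  nlinarith [mul_nonneg hβ (add_nonneg h1 h2), key]

/-- **`{b,v}`-cut lemma (algebraic core, memo §5.2(a)).**  `G = G₁ ∪_{b,v} G₂`, `a ∈ G₁`, `c ∈ G₂`;
`t₁, ub₁, uv₁` = weights of the partitions `{abv}`, `{ab|v}`, `{av|b}` of `G₁`; `t, ub, uc, ua, s,
      n` = the
six cells of `(G₂; v; b, c)`.  With `T = q(t₁(t+uc+ua) + ub₁t + uv₁t) + q²ub₁ua`,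
`U_b = q²(t₁(ub+s+n) + ub₁(ub+uc) + uv₁ub) + q³ub₁(s+n)`, `U_c = q²uv₁uc`, `S = q³uv₁s`, R1 and LG
      on the
far piece give `T·S ≤ U_b·U_c` for every `q ≥ 0`. [this work] -/
theorem bv_cut_certificate (q t₁ ub₁ uv₁ t ub uc ua s n : ℝ) (hq : 0 ≤ q) (ht₁ : 0 ≤ t₁)
    (hub₁ : 0 ≤ ub₁) (huv₁ : 0 ≤ uv₁) (huc : 0 ≤ uc) (hs : 0 ≤ s)
    (hR1 : s * t ≤ ub * uc) (hLG : s * ua ≤ n * uc) :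
    (q * (t₁ * (t + uc + ua) + ub₁ * t + uv₁ * t) + q ^ 2 * ub₁ * ua) * (q ^ 3 * uv₁ * s)
      ≤ (q ^ 2 * (t₁ * (ub + s + n) + ub₁ * (ub + uc) + uv₁ * ub) + q ^ 3 * ub₁ * (s + n))
        * (q ^ 2 * uv₁ * uc) := by
  have key : (q ^ 2 * (t₁ * (ub + s + n) + ub₁ * (ub + uc) + uv₁ * ub) + q ^ 3 * ub₁ * (s + n))
        * (q ^ 2 * uv₁ * uc)
      - (q * (t₁ * (t + uc + ua) + ub₁ * t + uv₁ * t) + q ^ 2 * ub₁ * ua) * (q ^ 3 * uv₁ * s)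
      = q ^ 4 * uv₁ * (t₁ * ((ub * uc - s * t) + (n * uc - s * ua)) + ub₁ * ((ub * uc - s * t) + uc
            * uc)
          + uv₁ * (ub * uc - s * t)) + q ^ 5 * uv₁ * (ub₁ * ((n * uc - s * ua) + uc * s)) := by ring
  have hA : 0 ≤ ub * uc - s * t := by linarith
  have hB : 0 ≤ n * uc - s * ua := by linarith
  have h1 : 0 ≤ t₁ * ((ub * uc - s * t) + (n * uc - s * ua)) + ub₁ * ((ub * uc - s * t) + uc * uc)
      + uv₁ * (ub * uc - s * t) :=
    add_nonneg (add_nonneg (mul_nonneg ht₁ (add_nonneg hA hB))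
      (mul_nonneg hub₁ (add_nonneg hA (mul_nonneg huc huc)))) (mul_nonneg huv₁ hA)
  have h2 : 0 ≤ ub₁ * ((n * uc - s * ua) + uc * s) :=
    mul_nonneg hub₁ (add_nonneg hB (mul_nonneg huc hs))
  have hq4 : 0 ≤ q ^ 4 * uv₁ := mul_nonneg (pow_nonneg hq 4) huv₁
  have hq5 : 0 ≤ q ^ 5 * uv₁ := mul_nonneg (pow_nonneg hq 5) huv₁
  nlinarith [mul_nonneg hq4 h1, mul_nonneg hq5 h2, key]

end WheelR1

end Summit.CriticalPhenomena.PercolationContinuityZ3.Theorems
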